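import Mathlib
import Summits.NavierStokesRegularity.NavierStokesRegularity.Theorems.FilamentSkeletonRssDefectColumnGateAzimuthalBlockCoreTrunc

/-!
# Route `FilamentSkeletonRss` · crux `TransverseReduction1AG` (stmt-NavierStokesRegularity-27853; A1L twin stmt-23297) · line
# `defect_column_gate_1AG/1AL` — the TRUNCATED Gaussian-core DISSIPATION bound of the Biot–Savart-coupled azimuthal blocks `m ≥ 2` of
# S2a-loc `WaistColumnGateLoc1A` — brick (Re) of the seat's two-zone scheme

Helper file (`--supports stmt-NavierStokesRegularity-27853 --as helper`; seat ns-filament-s2aloc-p1 g2; note ARCHITECTURE-B2B3-s2aloc-g2.md v2 §6).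
Built on `…AzimuthalBlockCoreTrunc.lean` (p673215, brick (Im)), `…AzimuthalBlockCore.lean` (p672582), `…AzimuthalBlockRotationFlux.lean`
(p672041/p672794: `modulusFlux_gauss_integral_sub`).

THE RESULT (`core_dissipation_trunc`; dictionary as in `…AzimuthalBlockCore.lean`).  For `m ≥ 2`, every `Rc ≥ 0`, every `ρ`, `0 ≤ u₁ ≤ U`, the two
Gaussian DISSIPATION CURRENCIES of the core, `D = ∫₀^{u₁} E·4u(a′²+b′²)` and `D₂ = ∫₀^{u₁} E·m²(a²+b²)/u` (`E = e^{γu/4}`), obey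
`D + D₂ ≤ γ∫₀^{u₁}E(a²+b²) + ∫₀^{u₁}E(a f₁ + b f₂) + E(u₁)(aΦ_a + bΦ_b − γu₁(a²+b²))(u₁) + (16/(5m))·Rc∫₀^{u₁}EΩ(a²+b²) + (γ²Rc/(16πm))∫_{u₁}^U u(a²+b²)`:
the truncated real-part identity (`modulusFlux_gauss_integral_sub`) with the Biot–Savart cross term `E c_B(bφ_a − aφ_b) = (γ²mRc/8π)(bφ_a − aφ_b)`
bounded by AM–GM and the GLOBAL Biot–Savart Hardy bound `∫₀^{u₁}(m²/u)φ_a² ≤ (1/m²)∫₀^U u a²` (`bsHardy_trunc_le`, no boundary term, no decay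
estimate), then by the rotation term through `bs_rotation_pointwise`.  Together with (Im) `core_rotation_coercivity_trunc` (which pays `Rc∫EΩs` by
the forcing) this puts BOTH currencies — hence, via `sq_le_extraction(_of_mem)` (`…AzimuthalBlockTools.lean`), the sup of the modulus on the core —
under the control of the forcing, the boundary fluxes at `u₁` (layer-averaged by `exists_mul_le_integral`) and the exterior sup (p671778).
HONEST FRAMING: inequalities about ONE family of blocks of ONE linear MODEL operator of a hypothetical blow-up route (MODEL rung, negative side);
nothing here bears on NS regularity.
-/

set_option linter.dupNamespace false

noncomputable section

namespace Summit.NavierStokesRegularity.NavierStokesRegularity.Theorems.DefectColumnGate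

open scoped Topology
open Set Filter MeasureTheory intervalIntegral

/-- **Truncated Biot–Savart Hardy bound (no boundary term).**  Under the global hypotheses of `bsPairing_le` on `[0,U]`: for `0 ≤ u₁ ≤ U`,
`∫₀^{u₁}(m²/u)φ² ≤ (1/m²)∫₀^U u a²` — from `∫₀^{u₁} ≤ ∫₀^U (m²/u)φ² ≤ ∫₀^U(4uφ′² + (m²/u)φ²) = ∫₀^U aφ ≤ (1/m²)∫₀^U u a²`. -/
theorem bsHardy_trunc_le {m u₁ U : ℝ} {a φ φ₁ : ℝ → ℝ} (hm : m ≠ 0) (hu₁ : 0 ≤ u₁) (hu₁U : u₁ ≤ U)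
    (hφ : ContinuousOn φ (Icc 0 U)) (hP : ContinuousOn (fun s => s * φ₁ s) (Icc 0 U)) (hφ0 : φ 0 = 0)
    (hder : ∀ u ∈ Ioo 0 U, HasDerivAt φ (φ₁ u) u)
    (hflux : ∀ u ∈ Ioo 0 U, HasDerivAt (fun s => s * φ₁ s) ((m ^ 2 / u * φ u - a u) / 4) u)
    (hφU : φ U = 0)
    (hIaφ : IntervalIntegrable (fun u => a u * φ u) volume 0 U)
    (hIB₁ : IntervalIntegrable (fun u => 4 * u * φ₁ u ^ 2) volume 0 U)
    (hIB₂ : IntervalIntegrable (fun u => m ^ 2 / u * φ u ^ 2) volume 0 U)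
    (hIua : IntervalIntegrable (fun u => u * a u ^ 2) volume 0 U) :
    ∫ u in (0:ℝ)..u₁, m ^ 2 / u * φ u ^ 2 ≤ 1 / m ^ 2 * ∫ u in (0:ℝ)..U, u * a u ^ 2 := by
  have hU : 0 ≤ U := hu₁.trans hu₁U
  have hglob := bsPairing_le hm hU hφ hP hφ0 hder hflux hφU hIaφ hIB₁ hIB₂ hIua
  have hid := bsPairing_integral hU hφ hP hder hflux hφU hIaφ (hIB₁.add hIB₂)
  have hmonoB : ∫ u in (0:ℝ)..u₁, m ^ 2 / u * φ u ^ 2 ≤ ∫ u in (0:ℝ)..U, m ^ 2 / u * φ u ^ 2 := by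
    apply integral_mono_interval le_rfl hu₁ hu₁U
    · refine MeasureTheory.ae_restrict_of_forall_mem measurableSet_Ioc (fun u hu => ?_)
      have : 0 < u := hu.1
      positivity
    · exact hIB₂
  have hB₁ : 0 ≤ ∫ u in (0:ℝ)..U, 4 * u * φ₁ u ^ 2 :=
    integral_nonneg hU (fun u hu => by have := hu.1; positivity)
  have hsum : ∫ u in (0:ℝ)..U, (4 * u * φ₁ u ^ 2 + m ^ 2 / u * φ u ^ 2)
      = (∫ u in (0:ℝ)..U, 4 * u * φ₁ u ^ 2) + ∫ u in (0:ℝ)..U, m ^ 2 / u * φ u ^ 2 := integral_add hIB₁ hIB₂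
  have h1 : ∫ u in (0:ℝ)..U, m ^ 2 / u * φ u ^ 2 ≤ ∫ u in (0:ℝ)..U, a u * φ u := by rw [hid, hsum]; linarith
  linarith [hglob.2]

set_option maxHeartbeats 800000 in
/-- **Truncated core dissipation bound (`m ≥ 2`, every `Rc ≥ 0`).**  Under the hypotheses of `core_rotation_coercivity_trunc` plus integrability
of the dissipation integrand and of `E(a f₁ + b f₂)` on `[0,U]`, for `0 ≤ u₁ ≤ U`:
`∫₀^{u₁}E[4u(a₁²+b₁²) + (m²/u)(a²+b²)] ≤ γ∫₀^{u₁}E(a²+b²) + ∫₀^{u₁}E(a f₁ + b f₂) + E(u₁)(aΦ_a + bΦ_b − γu₁(a²+b²))(u₁)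
  + (16/(5m))Rc∫₀^{u₁}EΩ(a²+b²) + (γ²Rc/(16πm))∫_{u₁}^U u(a²+b²)`. -/
theorem core_dissipation_trunc {γ m ρ Rc u₁ U : ℝ} {a a₁ b b₁ φa φa₁ φb φb₁ f₁ f₂ : ℝ → ℝ}
    (hγ : 0 < γ) (hm : 2 ≤ m) (hRc : 0 ≤ Rc) (hu₁ : 0 ≤ u₁) (hu₁U : u₁ ≤ U)
    (ha : ContinuousOn a (Icc 0 U)) (hb : ContinuousOn b (Icc 0 U))
    (hφa : ContinuousOn φa (Icc 0 U)) (hφb : ContinuousOn φb (Icc 0 U))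
    (hΦac : ContinuousOn (fun s => 4 * s * a₁ s + γ * s * a s) (Icc 0 U))
    (hΦbc : ContinuousOn (fun s => 4 * s * b₁ s + γ * s * b s) (Icc 0 U))
    (hPac : ContinuousOn (fun s => s * φa₁ s) (Icc 0 U)) (hPbc : ContinuousOn (fun s => s * φb₁ s) (Icc 0 U))
    (hφa0 : φa 0 = 0) (hφb0 : φb 0 = 0)
    (hdera : ∀ u ∈ Ioo 0 U, HasDerivAt a (a₁ u) u) (hderb : ∀ u ∈ Ioo 0 U, HasDerivAt b (b₁ u) u)
    (hderφa : ∀ u ∈ Ioo 0 U, HasDerivAt φa (φa₁ u) u) (hderφb : ∀ u ∈ Ioo 0 U, HasDerivAt φb (φb₁ u) u)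
    (hΦa : ∀ u ∈ Ioo 0 U, HasDerivAt (fun s => 4 * s * a₁ s + γ * s * a s)
      (m ^ 2 / u * a u - m * (ρ + Rc * ((1 - Real.exp (-(γ * u / 4))) / (2 * Real.pi * u))) * b u
        + γ * m * Rc / 2 * (γ / (4 * Real.pi) * Real.exp (-(γ * u / 4))) * φb u - f₁ u) u)
    (hΦb : ∀ u ∈ Ioo 0 U, HasDerivAt (fun s => 4 * s * b₁ s + γ * s * b s)
      (m ^ 2 / u * b u + m * (ρ + Rc * ((1 - Real.exp (-(γ * u / 4))) / (2 * Real.pi * u))) * a u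
        - γ * m * Rc / 2 * (γ / (4 * Real.pi) * Real.exp (-(γ * u / 4))) * φa u - f₂ u) u)
    (hPa : ∀ u ∈ Ioo 0 U, HasDerivAt (fun s => s * φa₁ s) ((m ^ 2 / u * φa u - a u) / 4) u)
    (hPb : ∀ u ∈ Ioo 0 U, HasDerivAt (fun s => s * φb₁ s) ((m ^ 2 / u * φb u - b u) / 4) u)
    (hφaU : φa U = 0) (hφbU : φb U = 0)
    (hIΩ : IntervalIntegrable (fun u => Real.exp (γ * u / 4)
      * ((1 - Real.exp (-(γ * u / 4))) / (2 * Real.pi * u)) * (a u ^ 2 + b u ^ 2)) volume 0 U)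
    (hIE : IntervalIntegrable (fun u => Real.exp (γ * u / 4) * (a u ^ 2 + b u ^ 2)) volume 0 U)
    (hIg : IntervalIntegrable (fun u => Real.exp (γ * u / 4) * (a u * f₁ u + b u * f₂ u)) volume 0 U)
    (hID : IntervalIntegrable (fun u => Real.exp (γ * u / 4)
      * (4 * u * (a₁ u ^ 2 + b₁ u ^ 2) + m ^ 2 / u * (a u ^ 2 + b u ^ 2))) volume 0 U)
    (hIaφ : IntervalIntegrable (fun u => a u * φa u) volume 0 U)
    (hIbφ : IntervalIntegrable (fun u => b u * φb u) volume 0 U)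
    (hIBa₁ : IntervalIntegrable (fun u => 4 * u * φa₁ u ^ 2) volume 0 U)
    (hIBa₂ : IntervalIntegrable (fun u => m ^ 2 / u * φa u ^ 2) volume 0 U)
    (hIBb₁ : IntervalIntegrable (fun u => 4 * u * φb₁ u ^ 2) volume 0 U)
    (hIBb₂ : IntervalIntegrable (fun u => m ^ 2 / u * φb u ^ 2) volume 0 U)
    (hIua : IntervalIntegrable (fun u => u * a u ^ 2) volume 0 U)
    (hIub : IntervalIntegrable (fun u => u * b u ^ 2) volume 0 U)
    (hIcross : IntervalIntegrable (fun u => b u * φa u - a u * φb u) volume 0 U) :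
    ∫ u in (0:ℝ)..u₁, Real.exp (γ * u / 4) * (4 * u * (a₁ u ^ 2 + b₁ u ^ 2) + m ^ 2 / u * (a u ^ 2 + b u ^ 2))
      ≤ γ * (∫ u in (0:ℝ)..u₁, Real.exp (γ * u / 4) * (a u ^ 2 + b u ^ 2))
        + (∫ u in (0:ℝ)..u₁, Real.exp (γ * u / 4) * (a u * f₁ u + b u * f₂ u))
        + Real.exp (γ * u₁ / 4) * (a u₁ * (4 * u₁ * a₁ u₁ + γ * u₁ * a u₁) + b u₁ * (4 * u₁ * b₁ u₁ + γ * u₁ * b u₁)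
            - γ * u₁ * (a u₁ ^ 2 + b u₁ ^ 2))
        + 16 / (5 * m) * Rc * (∫ u in (0:ℝ)..u₁, Real.exp (γ * u / 4)
            * ((1 - Real.exp (-(γ * u / 4))) / (2 * Real.pi * u)) * (a u ^ 2 + b u ^ 2))
        + γ ^ 2 * Rc / (16 * Real.pi * m) * ∫ u in u₁..U, u * (a u ^ 2 + b u ^ 2) := by
  have hm0 : 0 < m := by linarith
  have hm0' : m ≠ 0 := hm0.ne'
  have hπ : 0 < Real.pi := Real.pi_pos
  have hU : 0 ≤ U := hu₁.trans hu₁U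
  have hsub : Icc 0 u₁ ⊆ Icc 0 U := Icc_subset_Icc le_rfl hu₁U
  have hsubo : Ioo 0 u₁ ⊆ Ioo 0 U := Ioo_subset_Ioo le_rfl hu₁U
  -- names
  set V : ℝ → ℝ := fun u => m * (ρ + Rc * ((1 - Real.exp (-(γ * u / 4))) / (2 * Real.pi * u))) with hVdef
  set cB : ℝ → ℝ := fun u => γ * m * Rc / 2 * (γ / (4 * Real.pi) * Real.exp (-(γ * u / 4))) with hcBdef
  set F₁ : ℝ → ℝ := fun u => f₁ u - cB u * φb u with hF₁def
  set F₂ : ℝ → ℝ := fun u => f₂ u + cB u * φa u with hF₂def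
  have hEcB : ∀ u, Real.exp (γ * u / 4) * cB u = γ ^ 2 * m * Rc / (8 * Real.pi) := by
    intro u
    simp only [hcBdef]
    have hE : Real.exp (γ * u / 4) ≠ 0 := (Real.exp_pos _).ne'
    rw [Real.exp_neg]
    field_simp
    ring
  -- truncated integrability
  have hIΩ' := intervalIntegrable_mono_left hu₁ hu₁U hIΩ
  have hIE' := intervalIntegrable_mono_left hu₁ hu₁U hIE
  have hIg' := intervalIntegrable_mono_left hu₁ hu₁U hIg
  have hID' := intervalIntegrable_mono_left hu₁ hu₁U hID
  have hIua' := intervalIntegrable_mono_left hu₁ hu₁U hIua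
  have hIub' := intervalIntegrable_mono_left hu₁ hu₁U hIub
  have hIBa₂' := intervalIntegrable_mono_left hu₁ hu₁U hIBa₂
  have hIBb₂' := intervalIntegrable_mono_left hu₁ hu₁U hIBb₂
  have hIcross' := intervalIntegrable_mono_left hu₁ hu₁U hIcross
  -- (1) the truncated real-part identity with `f' = f − BS`
  have hA : ∀ u ∈ Ioo 0 u₁, HasDerivAt (fun s => 4 * s * a₁ s + γ * s * a s) (m ^ 2 / u * a u - V u * b u - F₁ u) u :=
    fun u hu => (hΦa u (hsubo hu)).congr_deriv (by simp only [hVdef, hF₁def, hcBdef]; ring)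
  have hB : ∀ u ∈ Ioo 0 u₁, HasDerivAt (fun s => 4 * s * b₁ s + γ * s * b s) (m ^ 2 / u * b u + V u * a u - F₂ u) u :=
    fun u hu => (hΦb u (hsubo hu)).congr_deriv (by simp only [hVdef, hF₂def, hcBdef]; ring)
  -- the integrand of `modulusFlux_gauss_integral_sub`, rewritten
  have hint_eq : ∀ u, Real.exp (γ * u / 4) * (4 * u * (a₁ u ^ 2 + b₁ u ^ 2)
      + (m ^ 2 / u - γ) * (a u ^ 2 + b u ^ 2) - (a u * F₁ u + b u * F₂ u)) / 2
      = (Real.exp (γ * u / 4) * (4 * u * (a₁ u ^ 2 + b₁ u ^ 2) + m ^ 2 / u * (a u ^ 2 + b u ^ 2))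
        - γ * (Real.exp (γ * u / 4) * (a u ^ 2 + b u ^ 2))
        - Real.exp (γ * u / 4) * (a u * f₁ u + b u * f₂ u)
        - γ ^ 2 * m * Rc / (8 * Real.pi) * (b u * φa u - a u * φb u)) / 2 := by
    intro u
    have h := hEcB u
    simp only [hF₁def, hF₂def]
    linear_combination (-(1 / 2) * (b u * φa u - a u * φb u)) * h
  have hint : IntervalIntegrable (fun u => Real.exp (γ * u / 4) * (4 * u * (a₁ u ^ 2 + b₁ u ^ 2)
      + (m ^ 2 / u - γ) * (a u ^ 2 + b u ^ 2) - (a u * F₁ u + b u * F₂ u)) / 2) volume 0 u₁ := by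
    have e : (fun u => Real.exp (γ * u / 4) * (4 * u * (a₁ u ^ 2 + b₁ u ^ 2)
        + (m ^ 2 / u - γ) * (a u ^ 2 + b u ^ 2) - (a u * F₁ u + b u * F₂ u)) / 2)
        = fun u => (Real.exp (γ * u / 4) * (4 * u * (a₁ u ^ 2 + b₁ u ^ 2) + m ^ 2 / u * (a u ^ 2 + b u ^ 2))
          - γ * (Real.exp (γ * u / 4) * (a u ^ 2 + b u ^ 2))
          - Real.exp (γ * u / 4) * (a u * f₁ u + b u * f₂ u)
          - γ ^ 2 * m * Rc / (8 * Real.pi) * (b u * φa u - a u * φb u)) / 2 := by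
      funext u; exact hint_eq u
    rw [e]
    exact (((hID'.sub (hIE'.const_mul γ)).sub hIg').sub (hIcross'.const_mul _)).div_const 2
  have hFTC := modulusFlux_gauss_integral_sub hu₁ (ha.mono hsub) (hb.mono hsub) (hΦac.mono hsub) (hΦbc.mono hsub)
    (fun u hu => hdera u (hsubo hu)) (fun u hu => hderb u (hsubo hu)) hA hB hint
  have hsplit : ∫ u in (0:ℝ)..u₁, Real.exp (γ * u / 4) * (4 * u * (a₁ u ^ 2 + b₁ u ^ 2)
      + (m ^ 2 / u - γ) * (a u ^ 2 + b u ^ 2) - (a u * F₁ u + b u * F₂ u)) / 2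
      = ((∫ u in (0:ℝ)..u₁, Real.exp (γ * u / 4) * (4 * u * (a₁ u ^ 2 + b₁ u ^ 2) + m ^ 2 / u * (a u ^ 2 + b u ^ 2)))
        - γ * (∫ u in (0:ℝ)..u₁, Real.exp (γ * u / 4) * (a u ^ 2 + b u ^ 2))
        - (∫ u in (0:ℝ)..u₁, Real.exp (γ * u / 4) * (a u * f₁ u + b u * f₂ u))
        - γ ^ 2 * m * Rc / (8 * Real.pi) * (∫ u in (0:ℝ)..u₁, (b u * φa u - a u * φb u))) / 2 := by
    rw [← intervalIntegral.integral_const_mul, ← intervalIntegral.integral_const_mul,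
      ← integral_sub hID' (hIE'.const_mul γ), ← integral_sub (hID'.sub (hIE'.const_mul γ)) hIg',
      ← integral_sub ((hID'.sub (hIE'.const_mul γ)).sub hIg') (hIcross'.const_mul _),
      ← intervalIntegral.integral_div]
    congr 1; funext u; rw [hint_eq u]
  rw [hsplit] at hFTC
  norm_num at hFTC
  -- (2) the Biot–Savart cross term by AM–GM and the global Hardy bound
  have hHa := bsHardy_trunc_le hm0' hu₁ hu₁U hφa hPac hφa0 hderφa hPa hφaU hIaφ hIBa₁ hIBa₂ hIua
  have hHb := bsHardy_trunc_le hm0' hu₁ hu₁U hφb hPbc hφb0 hderφb hPb hφbU hIbφ hIBb₁ hIBb₂ hIub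
  have hcross : ∫ u in (0:ℝ)..u₁, (b u * φa u - a u * φb u)
      ≤ ∫ u in (0:ℝ)..u₁, ((1 / m ^ 2) * (u * a u ^ 2 + u * b u ^ 2) + (m ^ 2 / u * φa u ^ 2 + m ^ 2 / u * φb u ^ 2)) / 2 := by
    apply integral_mono_on hu₁ hIcross' ((((hIua'.add hIub').const_mul (1 / m ^ 2)).add (hIBa₂'.add hIBb₂')).div_const 2)
    intro u hu
    rcases eq_or_lt_of_le hu.1 with h | h
    · subst h; simp [hφa0, hφb0]
    · have k1 : 0 ≤ (u * b u - m ^ 2 * φa u) ^ 2 / (2 * m ^ 2 * u) := by positivity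
      have k2 : 0 ≤ (u * a u + m ^ 2 * φb u) ^ 2 / (2 * m ^ 2 * u) := by positivity
      have e : ((1 / m ^ 2) * (u * a u ^ 2 + u * b u ^ 2) + (m ^ 2 / u * φa u ^ 2 + m ^ 2 / u * φb u ^ 2)) / 2
          - (b u * φa u - a u * φb u)
          = (u * b u - m ^ 2 * φa u) ^ 2 / (2 * m ^ 2 * u) + (u * a u + m ^ 2 * φb u) ^ 2 / (2 * m ^ 2 * u) := by
        field_simp; ring
      linarith [e, k1, k2]
  have hcross_split : ∫ u in (0:ℝ)..u₁, ((1 / m ^ 2) * (u * a u ^ 2 + u * b u ^ 2) + (m ^ 2 / u * φa u ^ 2 + m ^ 2 / u * φb u ^ 2)) / 2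
      = ((1 / m ^ 2) * ((∫ u in (0:ℝ)..u₁, u * a u ^ 2) + ∫ u in (0:ℝ)..u₁, u * b u ^ 2)
        + ((∫ u in (0:ℝ)..u₁, m ^ 2 / u * φa u ^ 2) + ∫ u in (0:ℝ)..u₁, m ^ 2 / u * φb u ^ 2)) / 2 := by
    rw [intervalIntegral.integral_div, integral_add ((hIua'.add hIub').const_mul _) (hIBa₂'.add hIBb₂'),
      intervalIntegral.integral_const_mul, integral_add hIua' hIub', integral_add hIBa₂' hIBb₂']
  rw [hcross_split] at hcross
  -- split `∫₀^U u a² = ∫₀^{u₁} + ∫_{u₁}^U`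
  have hsplitUa : ∫ u in (0:ℝ)..U, u * a u ^ 2 = (∫ u in (0:ℝ)..u₁, u * a u ^ 2) + ∫ u in u₁..U, u * a u ^ 2 :=
    (integral_add_adjacent_intervals hIua' (intervalIntegrable_mono_right hu₁ hu₁U hIua)).symm
  have hsplitUb : ∫ u in (0:ℝ)..U, u * b u ^ 2 = (∫ u in (0:ℝ)..u₁, u * b u ^ 2) + ∫ u in u₁..U, u * b u ^ 2 :=
    (integral_add_adjacent_intervals hIub' (intervalIntegrable_mono_right hu₁ hu₁U hIub)).symm
  have hext_sum : ∫ u in u₁..U, u * (a u ^ 2 + b u ^ 2) = (∫ u in u₁..U, u * a u ^ 2) + ∫ u in u₁..U, u * b u ^ 2 := by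
    rw [← integral_add (intervalIntegrable_mono_right hu₁ hu₁U hIua) (intervalIntegrable_mono_right hu₁ hu₁U hIub)]
    congr 1; funext u; ring
  -- (3) pointwise rotation/Biot–Savart comparison on the core (as in `core_rotation_coercivity_trunc`)
  have hcomp : γ ^ 2 * m * Rc / (8 * Real.pi) * (1 / m ^ 2) * ((∫ u in (0:ℝ)..u₁, u * a u ^ 2) + ∫ u in (0:ℝ)..u₁, u * b u ^ 2)
      ≤ 16 / (5 * m ^ 2) * (m * Rc) * (∫ u in (0:ℝ)..u₁, Real.exp (γ * u / 4)
          * ((1 - Real.exp (-(γ * u / 4))) / (2 * Real.pi * u)) * (a u ^ 2 + b u ^ 2)) := by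
    rw [← integral_add hIua' hIub', ← intervalIntegral.integral_const_mul, ← intervalIntegral.integral_const_mul]
    apply integral_mono_on hu₁ ((hIua'.add hIub').const_mul _) (hIΩ'.const_mul _)
    intro u hu
    have hs : 0 ≤ a u ^ 2 + b u ^ 2 := by positivity
    have hpt := bs_rotation_pointwise hγ hm hu.1
    have hE : Real.exp (γ * u / 4) * ((1 - Real.exp (-(γ * u / 4))) / (2 * Real.pi * u))
        = (Real.exp (γ * u / 4) - 1) / (2 * Real.pi * u) := by
      have : Real.exp (γ * u / 4) * Real.exp (-(γ * u / 4)) = 1 := by rw [← Real.exp_add]; simp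
      rw [mul_div_assoc', mul_sub, mul_one, this]
    have lhs_eq : γ ^ 2 * m * Rc / (8 * Real.pi) * (1 / m ^ 2) * (u * a u ^ 2 + u * b u ^ 2)
        = Rc * (γ ^ 2 / (8 * Real.pi * m) * u) * (a u ^ 2 + b u ^ 2) := by
      field_simp
    have rhs_eq : 16 / (5 * m ^ 2) * (m * Rc) * (Real.exp (γ * u / 4)
          * ((1 - Real.exp (-(γ * u / 4))) / (2 * Real.pi * u)) * (a u ^ 2 + b u ^ 2))
        = Rc * (16 / (5 * m ^ 2) * m * ((Real.exp (γ * u / 4) - 1) / (2 * Real.pi * u))) * (a u ^ 2 + b u ^ 2) := by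
      rw [hE]; ring
    rw [lhs_eq, rhs_eq]
    exact mul_le_mul_of_nonneg_right (mul_le_mul_of_nonneg_left hpt hRc) hs
  -- (4) assemble
  have hRcm : 0 ≤ γ ^ 2 * m * Rc / (8 * Real.pi) := by positivity
  set A₁ : ℝ := ∫ u in (0:ℝ)..u₁, u * a u ^ 2 with hA₁
  set B₁ : ℝ := ∫ u in (0:ℝ)..u₁, u * b u ^ 2 with hB₁
  set A₂ : ℝ := ∫ u in u₁..U, u * a u ^ 2 with hA₂
  set B₂ : ℝ := ∫ u in u₁..U, u * b u ^ 2 with hB₂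
  set Ha : ℝ := ∫ u in (0:ℝ)..u₁, m ^ 2 / u * φa u ^ 2 with hHadef
  set Hb : ℝ := ∫ u in (0:ℝ)..u₁, m ^ 2 / u * φb u ^ 2 with hHbdef
  set CΩ : ℝ := ∫ u in (0:ℝ)..u₁, Real.exp (γ * u / 4)
      * ((1 - Real.exp (-(γ * u / 4))) / (2 * Real.pi * u)) * (a u ^ 2 + b u ^ 2) with hCΩ
  rw [hsplitUa] at hHa
  rw [hsplitUb] at hHb
  have hcross2 : ∫ u in (0:ℝ)..u₁, (b u * φa u - a u * φb u) ≤ (1 / m ^ 2) * (A₁ + B₁) + 1 / (2 * m ^ 2) * (A₂ + B₂) := by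
    have e : ((1 / m ^ 2) * (A₁ + B₁) + ((1 / m ^ 2) * (A₁ + A₂) + (1 / m ^ 2) * (B₁ + B₂))) / 2
        = (1 / m ^ 2) * (A₁ + B₁) + 1 / (2 * m ^ 2) * (A₂ + B₂) := by
      field_simp; ring
    have h2 : ((1 / m ^ 2) * (A₁ + B₁) + (Ha + Hb)) / 2
        ≤ ((1 / m ^ 2) * (A₁ + B₁) + ((1 / m ^ 2) * (A₁ + A₂) + (1 / m ^ 2) * (B₁ + B₂))) / 2 := by linarith [hHa, hHb]
    linarith [hcross, h2, e]
  have hbs : γ ^ 2 * m * Rc / (8 * Real.pi) * ∫ u in (0:ℝ)..u₁, (b u * φa u - a u * φb u)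
      ≤ 16 / (5 * m) * Rc * CΩ + γ ^ 2 * Rc / (16 * Real.pi * m) * ∫ u in u₁..U, u * (a u ^ 2 + b u ^ 2) := by
    have h2 := mul_le_mul_of_nonneg_left hcross2 hRcm
    have h3 : γ ^ 2 * m * Rc / (8 * Real.pi) * (1 / (2 * m ^ 2) * (A₂ + B₂))
        = γ ^ 2 * Rc / (16 * Real.pi * m) * ∫ u in u₁..U, u * (a u ^ 2 + b u ^ 2) := by
      rw [hext_sum]; field_simp; ring
    have h4 : 16 / (5 * m ^ 2) * (m * Rc) * CΩ = 16 / (5 * m) * Rc * CΩ := by field_simp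
    calc γ ^ 2 * m * Rc / (8 * Real.pi) * ∫ u in (0:ℝ)..u₁, (b u * φa u - a u * φb u)
        ≤ γ ^ 2 * m * Rc / (8 * Real.pi) * ((1 / m ^ 2) * (A₁ + B₁) + 1 / (2 * m ^ 2) * (A₂ + B₂)) := h2
      _ = γ ^ 2 * m * Rc / (8 * Real.pi) * (1 / m ^ 2) * (A₁ + B₁)
          + γ ^ 2 * m * Rc / (8 * Real.pi) * (1 / (2 * m ^ 2) * (A₂ + B₂)) := by ring
      _ ≤ _ := by rw [h3, ← h4]; linarith [hcomp]
  linarith [hFTC, hbs]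

end Summit.NavierStokesRegularity.NavierStokesRegularity.Theorems.DefectColumnGate

end
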